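import Summits.NavierStokesRegularity.NavierStokesRegularity.Theorems.ExtremiserTransienceNearExtremalTransienceExtremiserLiouvilleNoAnalyticExtremalResidue
import HarnessLib

/-!
# Crux `ExtremiserTransience.NearExtremalTransience` (stmt-NavierStokesRegularity-21883), line `extremiser_liouville`,
# stub K1b — NO GAIN FROM CONSTANTS for the residue object; the HEMISPHERE LAW (its velocity image surrounds the origin)

`--supports stmt-NavierStokesRegularity-21883` (helper).  Author: prover seat `ns-el-k1b` (g5).

The extended admissible class (no `L²` condition) is invariant under constant shifts `v ↦ v − b`, which do not change
`S, Z, W`.  Hence g2's extended sharp inequality (`extendedSharp`: `|S| ≤ κ⋆ · sup‖·‖ · √Z · √W` on the extended class) applied to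
`v − b` shows that an extended EXTREMISER of constant speed `M` (`|S| = κ⋆ M √Z √W > 0`) gains nothing from constants:

* `exists_lt_norm_sub_of_constSpeed_extremal` : **`sup_x ‖v x − b‖ ≥ M` for every `b ∈ ℝ³`** (for every `M' < M` some `x` has
  `M' < ‖v x − b‖`) — the velocity image `v(ℝ³) ⊂ S²_M` is contained in no open ball of radius `M`;
* `exists_inner_lt_of_constSpeed_extremal` : **THE HEMISPHERE LAW — `inf_x ⟪v x, e⟫ ≤ 0` for every direction `e`** (apply the
  above to `b = (δ/‖e‖²)e`): the velocity image lies in no open hemisphere, i.e. `0 ∈ conv(closure v(ℝ³))`.  g2's REVERSAL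
  (`exists_inner_farField_nonpos_of_constSpeed_extremal`, direction `e = c` = the far field) is the special case that matters
  most; the general direction is the image-level form of the «no open half-space» law that the tree proves for `L²` ATTAINERS in
  four files (`…KStarAttainedHalfSpace*`, where constants are not admissible and wide truncated fields `curl(χ_L·½ b×x)` must be
  used).  For the constant-speed residue object the law is free, but only at the level of the IMAGE (the multiplier identity
  `∫ v dμ = 0` is still not derivable: constants are invisible to the first variation `ℓ`, cf. `Lines/…k1b_multiplier.md` item 4).

WHAT THIS IS NOT: K1b is NOT proved; nothing here proves NS regularity. [folklore]
-/

noncomputable section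

open Set Filter Topology MeasureTheory Metric Function
open scoped ENNReal NNReal Topology InnerProductSpace RealInnerProductSpace ContDiff
open Literature.Analysis.FluidPDE Literature.Analysis

namespace Summit.NavierStokesRegularity.NavierStokesRegularity.Theorems

-- the problem directory repeats the summit name (`NavierStokesRegularity/NavierStokesRegularity`)
set_option linter.dupNamespace false

namespace ExtremiserLiouville

variable {v : EuclideanSpace ℝ (Fin 3) → EuclideanSpace ℝ (Fin 3)}

/-- Shifting by a constant does not change `curl`. [folklore] -/
theorem curl_sub_const (v : EuclideanSpace ℝ (Fin 3) → EuclideanSpace ℝ (Fin 3)) (b : EuclideanSpace ℝ (Fin 3)) :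
    curl (fun x => v x - b) = curl v := by
  funext x
  rw [curl_eq_curlCLM, curl_eq_curlCLM, fderiv_sub_const]

/-- Shifting by a constant does not change `D¹` and `D²` (as `iteratedFDeriv`). [folklore] -/
theorem iteratedFDeriv_sub_const_of_ne (hv : ContDiff ℝ ∞ v) (b : EuclideanSpace ℝ (Fin 3)) {n : ℕ} (hn : n ≠ 0)
    (x : EuclideanSpace ℝ (Fin 3)) : iteratedFDeriv ℝ n (fun x => v x - b) x = iteratedFDeriv ℝ n v x := by
  have hf : ContDiffAt ℝ n v x := (hv.of_le (by exact_mod_cast le_top)).contDiffAt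
  have hg : ContDiffAt ℝ n (fun _ : EuclideanSpace ℝ (Fin 3) => b) x := contDiffAt_const
  have h := iteratedFDeriv_sub_apply hf hg
  have hfg : (v - fun _ => b) = fun x => v x - b := rfl
  rw [hfg] at h
  rw [h, iteratedFDeriv_const_of_ne hn, Pi.zero_apply, sub_zero]

/-- **NO GAIN FROM CONSTANTS for a constant-speed extended extremiser.**  If `v ∈ C^∞` is divergence free with `‖v‖ ≡ M`,
bounded gradient, `D¹v, D²v ∈ L²`, `M√Z√W > 0` and `|S| = κ⋆M√Z√W`, then for every constant `b` and every `M' < M` there is a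
point with `M' < ‖v x − b‖`: the sup norm cannot be lowered by a Galilean shift (else `v − b`, which has the same `S, Z, W`, would
beat the extended sharp inequality). [folklore] -/
theorem exists_lt_norm_sub_of_constSpeed_extremal
    (hv : ContDiff ℝ ∞ v) (hdiv : VectorCalculus.IsDivFree v) {M B : ℝ}
    (hM : ∀ x, ‖v x‖ = M) (hB : ∀ x, ‖fderiv ℝ v x‖ ≤ B)
    (h1 : ∫⁻ x, ‖iteratedFDeriv ℝ 1 v x‖ₑ ^ 2 < ⊤) (h2 : ∫⁻ x, ‖iteratedFDeriv ℝ 2 v x‖ₑ ^ 2 < ⊤)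
    (hpos : 0 < M * Real.sqrt (∫ x, ‖curl v x‖ ^ 2) * Real.sqrt (∫ x, frobeniusNormSq (fderiv ℝ (curl v) x)))
    (hatt : |∫ x, ⟪curl v x, fderiv ℝ v x (curl v x)⟫| = (sInf {κ : ℝ | (∀ (v : EuclideanSpace ℝ (Fin 3) → EuclideanSpace ℝ (Fin 3)) (M B : ℝ), ContDiff ℝ (⊤ : ℕ∞) v → Literature.Analysis.FluidPDE.VectorCalculus.IsDivFree v → (∀ x, ‖v x‖ ≤ M) → (∀ x, ‖fderiv ℝ v x‖ ≤ B) → (∫⁻ x, ‖iteratedFDeriv ℝ 0 v x‖ₑ ^ 2 < ⊤) → (∫⁻ x, ‖iteratedFDeriv ℝ 1 v x‖ₑ ^ 2 < ⊤) → (∫⁻ x, ‖iteratedFDeriv ℝ 2 v x‖ₑ ^ 2 < ⊤) → |∫ x, ⟪Literature.Analysis.FluidPDE.curl v x, fderiv ℝ v x (Literature.Analysis.FluidPDE.curl v x)⟫_ℝ| ≤ κ * M * Real.sqrt (∫ x, ‖Literature.Analysis.FluidPDE.curl v x‖ ^ 2) * Real.sqrt (∫ x, Literature.Analysis.FluidPDE.frobeniusNormSq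 (fderiv ℝ (Literature.Analysis.FluidPDE.curl v) x)))}) * M * Real.sqrt (∫ x, ‖curl v x‖ ^ 2) * Real.sqrt (∫ x, frobeniusNormSq (fderiv ℝ (curl v) x)))
    (b : EuclideanSpace ℝ (Fin 3)) {M' : ℝ} (hM' : M' < M) : ∃ x, M' < ‖v x - b‖ := by
  by_contra hno
  simp only [not_exists, not_lt] at hno
  set w : EuclideanSpace ℝ (Fin 3) → EuclideanSpace ℝ (Fin 3) := fun x => v x - b with hwdef
  have hK : 0 < (sInf {κ : ℝ | (∀ (v : EuclideanSpace ℝ (Fin 3) → EuclideanSpace ℝ (Fin 3)) (M B : ℝ), ContDiff ℝ (⊤ : ℕ∞) v → Literature.Analysis.FluidPDE.VectorCalculus.IsDivFree v → (∀ x, ‖v x‖ ≤ M) → (∀ x, ‖fderiv ℝ v x‖ ≤ B) → (∫⁻ x, ‖iteratedFDeriv ℝ 0 v x‖ₑ ^ 2 < ⊤) → (∫⁻ x, ‖iteratedFDeriv ℝ 1 v x‖ₑ ^ 2 < ⊤) → (∫⁻ x, ‖iteratedFDeriv ℝ 2 v x‖ₑ ^ 2 < ⊤) → |∫ x, ⟪Literature.Analysis.FluidPDE.curl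 v x, fderiv ℝ v x (Literature.Analysis.FluidPDE.curl v x)⟫_ℝ| ≤ κ * M * Real.sqrt (∫ x, ‖Literature.Analysis.FluidPDE.curl v x‖ ^ 2) * Real.sqrt (∫ x, Literature.Analysis.FluidPDE.frobeniusNormSq (fderiv ℝ (Literature.Analysis.FluidPDE.curl v) x)))}) := lt_trans (by norm_num) DepletionLadder.sharpDepletion_gt
  have hw : ContDiff ℝ ∞ w := hv.sub contDiff_const
  have hwdiv : VectorCalculus.IsDivFree w := isDivFree_sub_const hdiv b
  have hfd : ∀ x, fderiv ℝ w x = fderiv ℝ v x := fun x => by simp only [hwdef]; rw [fderiv_sub_const]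
  have hwB : ∀ x, ‖fderiv ℝ w x‖ ≤ B := fun x => by rw [hfd]; exact hB x
  have hw1 : ∫⁻ x, ‖iteratedFDeriv ℝ 1 w x‖ₑ ^ 2 < ⊤ := by
    have : (fun x => ‖iteratedFDeriv ℝ 1 w x‖ₑ ^ 2) = fun x => ‖iteratedFDeriv ℝ 1 v x‖ₑ ^ 2 := by
      funext x; rw [iteratedFDeriv_sub_const_of_ne hv b one_ne_zero]
    rw [this]; exact h1
  have hw2 : ∫⁻ x, ‖iteratedFDeriv ℝ 2 w x‖ₑ ^ 2 < ⊤ := by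
    have : (fun x => ‖iteratedFDeriv ℝ 2 w x‖ₑ ^ 2) = fun x => ‖iteratedFDeriv ℝ 2 v x‖ₑ ^ 2 := by
      funext x; rw [iteratedFDeriv_sub_const_of_ne hv b two_ne_zero]
    rw [this]; exact h2
  have hcurl : curl w = curl v := curl_sub_const v b
  have hsharp := extendedSharp w M' B hw hwdiv hno hwB hw1 hw2
  rw [hcurl] at hsharp
  simp only [hfd] at hsharp
  -- `hsharp : |S| ≤ κ⋆ M' √Z √W`, `hatt : |S| = κ⋆ M √Z √W`, and `κ⋆ √Z √W > 0`
  have hM0 : 0 ≤ M := (norm_nonneg _).trans (hM 0).le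
  have hZW : 0 < Real.sqrt (∫ x, ‖curl v x‖ ^ 2) * Real.sqrt (∫ x, frobeniusNormSq (fderiv ℝ (curl v) x)) := by
    have hZ0 : 0 ≤ Real.sqrt (∫ x, ‖curl v x‖ ^ 2) := Real.sqrt_nonneg _
    have hW0 : 0 ≤ Real.sqrt (∫ x, frobeniusNormSq (fderiv ℝ (curl v) x)) := Real.sqrt_nonneg _
    rcases (mul_nonneg hZ0 hW0).lt_or_eq with h | h
    · exact h
    · rw [mul_assoc, ← h, mul_zero] at hpos; exact absurd hpos (lt_irrefl 0)
  have hlt : (sInf {κ : ℝ | (∀ (v : EuclideanSpace ℝ (Fin 3) → EuclideanSpace ℝ (Fin 3)) (M B : ℝ), ContDiff ℝ (⊤ : ℕ∞) v → Literature.Analysis.FluidPDE.VectorCalculus.IsDivFree v → (∀ x, ‖v x‖ ≤ M) → (∀ x, ‖fderiv ℝ v x‖ ≤ B) → (∫⁻ x, ‖iteratedFDeriv ℝ 0 v x‖ₑ ^ 2 < ⊤) → (∫⁻ x, ‖iteratedFDeriv ℝ 1 v x‖ₑ ^ 2 < ⊤) → (∫⁻ x, ‖iteratedFDeriv ℝ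 2 v x‖ₑ ^ 2 < ⊤) → |∫ x, ⟪Literature.Analysis.FluidPDE.curl v x, fderiv ℝ v x (Literature.Analysis.FluidPDE.curl v x)⟫_ℝ| ≤ κ * M * Real.sqrt (∫ x, ‖Literature.Analysis.FluidPDE.curl v x‖ ^ 2) * Real.sqrt (∫ x, Literature.Analysis.FluidPDE.frobeniusNormSq (fderiv ℝ (Literature.Analysis.FluidPDE.curl v) x)))}) * M' * Real.sqrt (∫ x, ‖curl v x‖ ^ 2) * Real.sqrt (∫ x, frobeniusNormSq (fderiv ℝ (curl v) x)) <
      (sInf {κ : ℝ | (∀ (v : EuclideanSpace ℝ (Fin 3) → EuclideanSpace ℝ (Fin 3)) (M B : ℝ), ContDiff ℝ (⊤ : ℕ∞) v → Literature.Analysis.FluidPDE.VectorCalculus.IsDivFree v → (∀ x, ‖v x‖ ≤ M) → (∀ x, ‖fderiv ℝ v x‖ ≤ B) → (∫⁻ x, ‖iteratedFDeriv ℝ 0 v x‖ₑ ^ 2 < ⊤) → (∫⁻ x, ‖iteratedFDeriv ℝ 1 v x‖ₑ ^ 2 < ⊤) → (∫⁻ x, ‖iteratedFDeriv ℝ 2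 v x‖ₑ ^ 2 < ⊤) → |∫ x, ⟪Literature.Analysis.FluidPDE.curl v x, fderiv ℝ v x (Literature.Analysis.FluidPDE.curl v x)⟫_ℝ| ≤ κ * M * Real.sqrt (∫ x, ‖Literature.Analysis.FluidPDE.curl v x‖ ^ 2) * Real.sqrt (∫ x, Literature.Analysis.FluidPDE.frobeniusNormSq (fderiv ℝ (Literature.Analysis.FluidPDE.curl v) x)))}) * M * Real.sqrt (∫ x, ‖curl v x‖ ^ 2) * Real.sqrt (∫ x, frobeniusNormSq (fderiv ℝ (curl v) x)) := by
    have := mul_lt_mul_of_pos_right (mul_lt_mul_of_pos_left hM' hK) hZW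
    simpa only [mul_assoc] using this
  rw [← hatt] at hlt
  exact absurd (lt_of_le_of_lt hsharp hlt) (lt_irrefl _)

/-- **THE HEMISPHERE LAW.**  For a constant-speed extended extremiser (hypotheses as above), **`inf_x ⟪v x, e⟫ ≤ 0` for every
`e ∈ ℝ³`**: for every `δ > 0` some point has `⟪v x, e⟫ < δ`.  Equivalently the velocity image lies in no open hemisphere of the
sphere `‖·‖ = M` (`0 ∈ conv(closure v(ℝ³))`).  Proof: otherwise `b = (δ/‖e‖²)e` lowers the sup norm,
`‖v x − b‖² = M² − 2(δ/‖e‖²)⟪v x, e⟫ + δ²/‖e‖² ≤ M² − δ²/‖e‖²`. [folklore] -/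
theorem exists_inner_lt_of_constSpeed_extremal
    (hv : ContDiff ℝ ∞ v) (hdiv : VectorCalculus.IsDivFree v) {M B : ℝ}
    (hM : ∀ x, ‖v x‖ = M) (hB : ∀ x, ‖fderiv ℝ v x‖ ≤ B)
    (h1 : ∫⁻ x, ‖iteratedFDeriv ℝ 1 v x‖ₑ ^ 2 < ⊤) (h2 : ∫⁻ x, ‖iteratedFDeriv ℝ 2 v x‖ₑ ^ 2 < ⊤)
    (hpos : 0 < M * Real.sqrt (∫ x, ‖curl v x‖ ^ 2) * Real.sqrt (∫ x, frobeniusNormSq (fderiv ℝ (curl v) x)))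
    (hatt : |∫ x, ⟪curl v x, fderiv ℝ v x (curl v x)⟫| = (sInf {κ : ℝ | (∀ (v : EuclideanSpace ℝ (Fin 3) → EuclideanSpace ℝ (Fin 3)) (M B : ℝ), ContDiff ℝ (⊤ : ℕ∞) v → Literature.Analysis.FluidPDE.VectorCalculus.IsDivFree v → (∀ x, ‖v x‖ ≤ M) → (∀ x, ‖fderiv ℝ v x‖ ≤ B) → (∫⁻ x, ‖iteratedFDeriv ℝ 0 v x‖ₑ ^ 2 < ⊤) → (∫⁻ x, ‖iteratedFDeriv ℝ 1 v x‖ₑ ^ 2 < ⊤) → (∫⁻ x, ‖iteratedFDeriv ℝ 2 v x‖ₑ ^ 2 < ⊤) → |∫ x, ⟪Literature.Analysis.FluidPDE.curl v x, fderiv ℝ v x (Literature.Analysis.FluidPDE.curl v x)⟫_ℝ| ≤ κ * M * Real.sqrt (∫ x, ‖Literature.Analysis.FluidPDE.curl v x‖ ^ 2) * Real.sqrt (∫ x, Literature.Analysis.FluidPDE.frobeniusNormSq (fderiv ℝ (Literature.Analysis.FluidPDE.curl v) x)))}) * M * Real.sqrt (∫ x, ‖curl v x‖ ^ 2) * Real.sqrt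 (∫ x, frobeniusNormSq (fderiv ℝ (curl v) x)))
    (e : EuclideanSpace ℝ (Fin 3)) {δ : ℝ} (hδ : 0 < δ) : ∃ x, ⟪v x, e⟫ < δ := by
  by_contra hno
  simp only [not_exists, not_lt] at hno
  -- `e ≠ 0`
  have he : e ≠ 0 := by
    intro h0
    have := hno 0
    rw [h0, inner_zero_right] at this
    linarith
  have he2 : 0 < ‖e‖ ^ 2 := by positivity
  have hM0 : 0 ≤ M := (norm_nonneg _).trans (hM 0).le
  have hMpos : 0 < M := by
    rcases hM0.lt_or_eq with h | h
    · exact h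
    · rw [← h, zero_mul, zero_mul] at hpos; exact absurd hpos (lt_irrefl 0)
  set b : EuclideanSpace ℝ (Fin 3) := (δ / ‖e‖ ^ 2) • e with hb
  -- the shifted norms
  have hsq : ∀ x, ‖v x - b‖ ^ 2 ≤ M ^ 2 - δ ^ 2 / ‖e‖ ^ 2 := fun x => by
    have hexp : ‖v x - b‖ ^ 2 = ‖v x‖ ^ 2 - 2 * ⟪v x, b⟫ + ‖b‖ ^ 2 := norm_sub_sq_real _ _
    have hvb : ⟪v x, b⟫ = (δ / ‖e‖ ^ 2) * ⟪v x, e⟫ := by rw [hb, inner_smul_right]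
    have hbb : ‖b‖ ^ 2 = δ ^ 2 / ‖e‖ ^ 2 := by
      rw [hb, norm_smul, Real.norm_eq_abs, abs_of_nonneg (by positivity), mul_pow]
      field_simp
    rw [hexp, hvb, hbb, hM x]
    have h := hno x
    have : 2 * (δ / ‖e‖ ^ 2 * ⟪v x, e⟫) ≥ 2 * (δ / ‖e‖ ^ 2 * δ) :=
      mul_le_mul_of_nonneg_left (mul_le_mul_of_nonneg_left h (by positivity)) (by norm_num)
    have e1 : 2 * (δ / ‖e‖ ^ 2 * δ) = 2 * (δ ^ 2 / ‖e‖ ^ 2) := by ring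
    linarith
  -- the radicand is nonnegative (the space is nonempty) and the new bound is `< M`
  have hrad : 0 ≤ M ^ 2 - δ ^ 2 / ‖e‖ ^ 2 := le_trans (sq_nonneg _) (hsq 0)
  set M' : ℝ := Real.sqrt (M ^ 2 - δ ^ 2 / ‖e‖ ^ 2) with hM'def
  have hM'lt : M' < M := by
    rw [hM'def, show M = Real.sqrt (M ^ 2) from (Real.sqrt_sq hMpos.le).symm]
    rw [Real.sqrt_sq hMpos.le]
    refine Real.sqrt_lt' hMpos |>.2 ?_
    have : 0 < δ ^ 2 / ‖e‖ ^ 2 := by positivity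
    linarith
  have hle : ∀ x, ‖v x - b‖ ≤ M' := fun x => by
    rw [hM'def, ← Real.sqrt_sq (norm_nonneg (v x - b))]
    exact Real.sqrt_le_sqrt (hsq x)
  obtain ⟨x, hx⟩ := exists_lt_norm_sub_of_constSpeed_extremal hv hdiv hM hB h1 h2 hpos hatt b hM'lt
  exact absurd (hle x) (not_le.2 hx)

end ExtremiserLiouville

end Summit.NavierStokesRegularity.NavierStokesRegularity.Theorems

end
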